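import Summits.CriticalPhenomena.CardyFormulaZ2.Theorems.CardyQContinuationIsingJetsConformalStubIsingCrossingConformal
import Summits.CriticalPhenomena.CardyFormulaZ2.Theorems.CardyQContinuationIsingJetsConformalStubIsingCrossingConformalNormalisation

/-!
# Stub 1 of line `registered` (crux `IsingJetsConformal`, stmt-CriticalPhenomena-5560) is
# "Chelkak–Smirnov 2012 Thm 6.1 on this discretisation" plus five lines

The registered stub `stub_isingCrossingConformal` (n = 0 of the crux: the critical FK-Ising crossing
probability `P_δ(√2)` of the `meshDomain`/`discreteArc` discretisation of a conformal rectangle, arcs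
`(ab)_δ ∪ (cd)_δ` JOINTLY wired, converges to a function of the cross-ratio) is not provable today: no
Literature fact states the Chelkak–Smirnov crossing theorem. This file machine-checks the lead's census
entry for it: the stub follows from ANY limit statement of Chelkak–Smirnov shape — convergence, for
every conformal rectangle with a uniformizing datum, of the crossing ratio in the LOOP-SYMMETRIC
normalisation `N_δ(√2) / (N_δ(√2) + √2 · M_δ(√2))`, `M_δ = Z^joint_δ - N_δ` (the quantity of
Chelkak–Smirnov 2012, Thm 6.1 / eq. (6.1)), written over the tree's two-arc polynomials
`fkTwoArcCrossingPolynomial`, `fkTwoArcPartitionPolynomials` — by the bridge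
`tendsto_crossingRatio_ofReal_iff` (p144240) and the Möbius transfer
`tendsto_aeval_div_of_tendsto_loopSymmetric` (p144247): `c_joint = √2 c / (√2 c + 1 - c)`.
The hypothesis is an anonymous proposition, NOT a Literature fact filed by this prover (it is the
crux's n = 0 case up to a Möbius map; filing it is the literature/planner seats' call, cf. the route's
DEFINITION REQUESTS). Registered as the sub-goal `stub_isingCrossingConformal_of_loopSymmetricLimit`.
-/

namespace Summit.CriticalPhenomena.CardyFormulaZ2.Theorems.CardyQContinuation

open Filter Polynomial
open scoped Topology
open Literature.Probability.LatticeModels Literature.Probability.RandomPlanarGeometry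

/-- **Loop-symmetric FK-Ising crossing limit ⇒ stub 1 (`stub_isingCrossingConformal`).** If for every
conformal rectangle `R` with uniformizing datum `(φ, x)` the critical FK-Ising crossing ratio of `Ω_δ`
in the loop-symmetric normalisation, `N_δ(√2)/(N_δ(√2) + √2 (Z^joint_δ(√2) - N_δ(√2)))`, tends to
`c (crossRatio x)` as `δ → 0⁺` (the shape of Chelkak–Smirnov 2012, Thm 6.1, on this discretisation),
then the route's jointly-wired `P_δ(√2)` tends to `√2 c(η)/(√2 c(η) + 1 - c(η))`, `η = crossRatio x`
— i.e. the registered stub holds with `c_joint := √2 c/(√2 c + 1 - c)`. [folklore] -/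
theorem stub_isingCrossingConformal_of_loopSymmetricLimit :
    (∃ c : ℝ → ℝ, ∀ (R : Literature.Probability.RandomPlanarGeometry.ConformalRectangle) (φ : Literature.Probability.RandomPlanarGeometry.ConformalEquiv UpperHalfPlane.upperHalfPlaneSet R.carrier) (x : Fin 4 → ℝ), R.IsUniformizing φ x → Filter.Tendsto (fun δ : ℝ ↦ Polynomial.aeval (Real.sqrt 2) (Literature.Probability.LatticeModels.fkTwoArcCrossingPolynomial R δ Literature.Probability.LatticeModels.ArcWiring.joint) / (Polynomial.aeval (Real.sqrt 2) (Literature.Probability.LatticeModels.fkTwoArcCrossingPolynomial R δ Literature.Probability.LatticeModels.ArcWiring.joint) + Real.sqrt 2 * (Polynomial.aeval (Real.sqrt 2) (Literature.Probability.LatticeModels.fkTwoArcPartitionPolynomials R δ Literature.Probability.LatticeModels.ArcWiring.joint) - Polynomial.aeval (Real.sqrt 2) (Literature.Probability.LatticeModels.fkTwoArcCrossingPolynomial R δ Literature.Probability.LatticeModels.ArcWiring.joint)))) (nhdsWithin 0 (Set.Ioi 0)) (nhds (c (Literature.Probability.RandomPlanarGeometry.crossRatio x)))) → (let w : Literature.Probability.RandomPlanarGeometry.ConformalRectangle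 → ℝ → ℂ → Set (Sym2 (Literature.Probability.LatticeModels.Site 2)) → ℂ := fun R δ s ω ↦ s ^ (ω.ncard + 2 * Nat.card ((Literature.Probability.Percolation.openGraph ω ⊔ Literature.Probability.LatticeModels.wired (Literature.Probability.LatticeModels.discreteArc R.carrier δ (R.arc 0) ∪ Literature.Probability.LatticeModels.discreteArc R.carrier δ (R.arc 2))).induce (Literature.Probability.LatticeModels.meshDomain R.carrier δ)).ConnectedComponent); let P : Literature.Probability.RandomPlanarGeometry.ConformalRectangle → ℝ → ℂ → ℂ := fun R δ s ↦ (∑ᶠ ω ∈ 𝒫 (Literature.Probability.LatticeModels.discreteDomainGraph R.carrier δ).edgeSet, (Literature.Probability.Percolation.discreteCrossing R.carrier δ (R.arc 0) (R.arc 2)).indicator (w R δ s) ω) / (∑ᶠ ω ∈ 𝒫 (Literature.Probability.LatticeModels.discreteDomainGraph R.carrier δ).edgeSet, w R δ s ω); ∃ c : ℝ → ℂ, ∀ (R : Literature.Probability.RandomPlanarGeometry.ConformalRectangle) (φ : Literature.Probability.RandomPlanarGeometry.ConformalEquiv UpperHalfPlane.upperHalfPlaneSet R.carrier) (x : Fin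 4 → ℝ), R.IsUniformizing φ x → Filter.Tendsto (fun δ ↦ P R δ (Real.sqrt 2 : ℂ)) (nhdsWithin 0 (Set.Ioi 0)) (nhds (c (Literature.Probability.RandomPlanarGeometry.crossRatio x)))) := by
  rintro ⟨c, hc⟩
  dsimp only
  refine ⟨fun η ↦ ((Real.sqrt 2 * c η / (Real.sqrt 2 * c η + 1 - c η) : ℝ) : ℂ),
    fun R φ x hU ↦ ?_⟩
  rw [tendsto_crossingRatio_ofReal_iff]
  exact tendsto_aeval_div_of_tendsto_loopSymmetric R (hc R φ x hU)

end Summit.CriticalPhenomena.CardyFormulaZ2.Theorems.CardyQContinuation
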